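import Summits.ResolutionOfSingularities.ResolutionOfSingularities.Theorems.FrobeniusLadderFInjectiveMacaulayficationStalkChartIso
import Summits.ResolutionOfSingularities.ResolutionOfSingularities.Theorems.FrobeniusLadderFInjectiveMacaulayficationReductions
import HarnessLib

/-!
# A chart prime failing the stalk clause gives a stalk of the blowing up failing it

Support file for crux stmt-ResolutionOfSingularities-15315
(`FrobeniusLadder.FInjectiveMacaulayfication`, line `Sketch`, lead seat c5, cycle 6, wave 2):
the registered helper stub `stub_affineBlowupStalkNotClause`, the NEGATIVE direction of the affine
blow-up glue E6/E6″ (chart ring → stalk), used by the characteristic-`3` calibration ("the point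
blow-up of `E₈⁰` is not F-injective in characteristic `3`").

`R` a commutative ring, `I` an ideal, `a ∈ I`, and `A = (R[It])_{(at)} = HomogeneousLocalization.Away
(reesGrading I) (reesT a ha)` the chart ring of the blowing up `affineBlowup I = Proj R[It]` at `a`.
If the crux's full per-stalk clause (domain; every system of parameters weakly regular; parameter
ideals Frobenius closed for the exponent base `p`, inline form) FAILS for the local ring `A_Q` of
the chart ring at a prime `Q`, then it fails at some stalk of `affineBlowup I`: the point
`y := Proj.awayι … q` (`q = Q` read as a point of `Spec A`) has stalk `𝒪_{Bl, y} ≃+* A_Q` — the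
chart map `Proj.awayι : Spec A ⟶ Proj R[It]` is an open immersion, so its stalk maps are
isomorphisms, and the stalk of `Spec A` at `q` is `A_q` (`Spec.stalkIso`) — and the clause
transports along ring isomorphisms (`fiClause_of_ringEquiv`). No domain, Noetherian or
characteristic hypothesis is needed.

* `nonempty_stalkAwayιEquiv` — the stalk `𝒪_{Bl, awayι q}` at a point `q` of the chart `Spec A`
  is ring-isomorphic to `A_q` (the construction of `StalkChartIso.stub_stalkChartIso`, stated for
  an arbitrary chart point);
* `stub_affineBlowupStalkNotClause` — the registered stub.

References: The Stacks Project, Tag 0804 (Lemma 31.32.2: the affine blowup algebras cover the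
blowing up); R. Hartshorne, *Algebraic Geometry*, Prop. II.2.5 (charts of `Proj`) and
Prop. II.2.2 (stalks of `Spec`); the rest is folklore.
-/

-- single-problem summit: the doubled namespace component is forced
set_option linter.dupNamespace false

noncomputable section

namespace Summit.ResolutionOfSingularities.ResolutionOfSingularities.Theorems.FInjectiveMacaulayfication.AffineBlowupStalkNotClause

open AlgebraicGeometry CategoryTheory Literature.AlgebraicGeometry.Resolution

/-- **Stalks of the blowing up on a chart are local rings of the chart ring.** For `a ∈ I` and a
point `q` of the chart `Spec A`, `A = (R[It])_{(at)}`, the stalk of `affineBlowup I = Proj R[It]` at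
the image of `q` under the open immersion `Proj.awayι : Spec A ⟶ Proj R[It]` is ring-isomorphic to
`A_q`: the stalk map of an open immersion is an isomorphism, and the stalk of `Spec A` at `q` is
`A_q` (`Spec.stalkIso`). [cite: StacksProject, Tag 0804] -/
theorem nonempty_stalkAwayιEquiv {R : Type} [CommRing R] {I : Ideal R} (a : R) (ha : a ∈ I)
    (q : PrimeSpectrum (HomogeneousLocalization.Away (reesGrading I) (reesT a ha))) :
    Nonempty (((affineBlowup I).presheaf.stalk
      ((Proj.awayι (reesGrading I) (reesT a ha) (reesT_mem a ha) Nat.one_pos).base q)) ≃+*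
        Localization.AtPrime q.asIdeal) :=
  ⟨((asIso ((Proj.awayι (reesGrading I) (reesT a ha) (reesT_mem a ha) Nat.one_pos).stalkMap q)
    ).commRingCatIsoToRingEquiv).trans
    (Spec.stalkIso (.of (HomogeneousLocalization.Away (reesGrading I) (reesT a ha))) q
      ).commRingCatIsoToRingEquiv⟩

/-- **E6 NEGATIVE DIRECTION: a chart prime failing the stalk clause gives a stalk of the blowing up
failing it** (registered stub `stub_affineBlowupStalkNotClause` of crux
stmt-ResolutionOfSingularities-15315, line `Sketch`). `R` a commutative ring, `I` an ideal, `a ∈ I`,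
`A = (R[It])_{(at)}` the chart ring. If the full per-stalk clause (domain ∧ every system of
parameters weakly regular ∧ parameter ideals Frobenius closed, inline form) fails for `A_Q` at a prime
`Q` of `A`, then it fails at the stalk of `affineBlowup I` at the point `y = Proj.awayι … Q` of the
chart `D₊(at) ≅ Spec A`: that stalk is ring-isomorphic to `A_Q` (`nonempty_stalkAwayιEquiv`), and the clause
transports along ring isomorphisms (`fiClause_of_ringEquiv`). [folklore] -/
theorem stub_affineBlowupStalkNotClause : ∀ (p : ℕ) (R : Type) [CommRing R] (I : Ideal R) (a : R) (ha : a ∈ I)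
    (Q : Ideal (HomogeneousLocalization.Away (reesGrading I) (reesT a ha))) [Q.IsPrime],
    ¬ (IsDomain (Localization.AtPrime Q) ∧
      ∀ d : ℕ, ringKrullDim (Localization.AtPrime Q) = d → ∀ s : Fin d → Localization.AtPrime Q,
        (Ideal.span (Set.range s)).radical.IsMaximal →
          RingTheory.Sequence.IsWeaklyRegular (Localization.AtPrime Q) (List.ofFn s) ∧
          ∀ y : Localization.AtPrime Q, (∃ e : ℕ, y ^ p ^ e ∈ Ideal.span
            ((fun z : Localization.AtPrime Q => z ^ p ^ e) ''
              (Ideal.span (Set.range s) : Set (Localization.AtPrime Q)))) → y ∈ Ideal.span (Set.range s)) →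
    ∃ y : ↥(affineBlowup I), ¬ (IsDomain ((affineBlowup I).presheaf.stalk y) ∧
      ∀ d : ℕ, ringKrullDim ((affineBlowup I).presheaf.stalk y) = d →
        ∀ s : Fin d → (affineBlowup I).presheaf.stalk y, (Ideal.span (Set.range s)).radical.IsMaximal →
          RingTheory.Sequence.IsWeaklyRegular ((affineBlowup I).presheaf.stalk y) (List.ofFn s) ∧
          ∀ z : (affineBlowup I).presheaf.stalk y, (∃ e : ℕ, z ^ p ^ e ∈
              Ideal.span ((fun w : (affineBlowup I).presheaf.stalk y => w ^ p ^ e) ''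
                (Ideal.span (Set.range s) : Set ((affineBlowup I).presheaf.stalk y)))) →
            z ∈ Ideal.span (Set.range s)) := by
  intro p R _ I a ha Q _ hnot
  -- the point `y = awayι q` of the chart `D₊(at)`, `q = Q ∈ Spec A`, has stalk `𝒪_y ≃+* A_Q`;
  -- were the clause to hold at `𝒪_y`, transport along this isomorphism would give it at `A_Q`
  obtain ⟨e⟩ := nonempty_stalkAwayιEquiv a ha ⟨Q, ‹_›⟩
  exact ⟨(Proj.awayι (reesGrading I) (reesT a ha) (reesT_mem a ha) Nat.one_pos).base ⟨Q, ‹_›⟩,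
    fun h => hnot (fiClause_of_ringEquiv p e h)⟩

end Summit.ResolutionOfSingularities.ResolutionOfSingularities.Theorems.FInjectiveMacaulayfication.AffineBlowupStalkNotClause
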